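import Summits.Ventures.PercRepro.RankLevelSetMinorPairUniform
import Summits.Ventures.PercRepro.RankLevelSetMinorPairDiag

/-! # RankLevelSetMinorPairRefutation — (M₀) AND (Diag) ARE FALSE: THE KERNEL REFUTATION ON A DIRECT SUM OF FOUR
UNIFORM MATROIDS (night-1 g29; dossier §41.12 (b))

The 12-element matroid `W = U_{2,3} ⊕ U_{2,3} ⊕ U_{3,4} ⊕ U_{1,2}` (elements `0–2 | 3–5 | 6–9 | 10–11`) with the split
signature `Y₁ = {0, 1, 10}`, `Y₂ = {3, 6}` has equal-rank complementary minors (`r(E ∖ Y₂) + #Y₂ = 8 + 2 =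
7 + 3 = r(E ∖ Y₁) + #Y₁`), `m = 7`, and the mixed profile `(0, 0, 6, 9, 5, 1, 0, 0)`: `p₂ = 6 > p₄ = 5` with
`2 + 4 = m − 1`. So **`not_minorPairEqualRankSkew_witness : ¬ MinorPairEqualRankSkew W`** and, through
`minorPairEqualRankSkew_of_diagSkew`, **`not_minorPairDiagSkew_witness : ¬ MinorPairDiagSkew W`**: the equal-rank
slice (M₀) and the diagonal (Diag) of the cumulative skew on pairs of complementary minors are NOT theorems of finite
matroid theory — the kernel reductions `biContainSkew_of_equalRankSkew` and `biContainSkew_of_diagSkew` have false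
hypotheses and are not routes to (CX*). The profile is computed exactly from the factors: the uniform windows
(`minorPairCount_uniform`) convolved three times (`minorPairCount_disjointSum`); the ranks from `mpRk_uniform` and
`mpRk_disjointSum`. (The 10-element witness `U_{1,2} ⊕ M(K_{2,3}) ⊕ U_{1,2}` of dossier §41.12 (a) is not in the cell's
Lean vocabulary; this all-uniform witness is.) Every declaration has a docstring; imports: the cell's own modules and
Mathlib only. Axioms: standard. -/

namespace PercRepro

open Set Matroid

namespace MinorPairWitness

/-- The ground set of the first summand `U_{2,3}`. -/
def E₁ : Finset ℕ := {0, 1, 2}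
/-- The ground set of the second summand `U_{2,3}`. -/
def E₂ : Finset ℕ := {3, 4, 5}
/-- The ground set of the third summand `U_{3,4}`. -/
def E₃ : Finset ℕ := {6, 7, 8, 9}
/-- The ground set of the fourth summand `U_{1,2}`. -/
def E₄ : Finset ℕ := {10, 11}

/-- `U_{2,3}` on `{0, 1, 2}`. -/
noncomputable def U₁ : Matroid ℕ := modelMatroid (E₁ : Set ℕ).toFinite ∅ 2 2
/-- `U_{2,3}` on `{3, 4, 5}`. -/
noncomputable def U₂ : Matroid ℕ := modelMatroid (E₂ : Set ℕ).toFinite ∅ 2 2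
/-- `U_{3,4}` on `{6, 7, 8, 9}`. -/
noncomputable def U₃ : Matroid ℕ := modelMatroid (E₃ : Set ℕ).toFinite ∅ 3 3
/-- `U_{1,2}` on `{10, 11}`. -/
noncomputable def U₄ : Matroid ℕ := modelMatroid (E₄ : Set ℕ).toFinite ∅ 1 1

/-- The ground set of `U₁`. -/
lemma U₁_E : U₁.E = (E₁ : Set ℕ) := rfl
/-- The ground set of `U₂`. -/
lemma U₂_E : U₂.E = (E₂ : Set ℕ) := rfl
/-- The ground set of `U₃`. -/
lemma U₃_E : U₃.E = (E₃ : Set ℕ) := rfl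
/-- The ground set of `U₄`. -/
lemma U₄_E : U₄.E = (E₄ : Set ℕ) := rfl

/-- `U₁` and `U₂` have disjoint ground sets. -/
lemma h₁₂ : Disjoint U₁.E U₂.E := by rw [U₁_E, U₂_E, Finset.disjoint_coe]; decide

/-- `U₁ ⊕ U₂`. -/
noncomputable def S₁₂ : Matroid ℕ := U₁.disjointSum U₂ h₁₂

/-- The ground set of `S₁₂`. -/
lemma S₁₂_E : S₁₂.E = (E₁ : Set ℕ) ∪ (E₂ : Set ℕ) := by
  rw [S₁₂, Matroid.disjointSum_ground_eq, U₁_E, U₂_E]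

/-- `S₁₂` and `U₃` have disjoint ground sets. -/
lemma h₁₂₃ : Disjoint S₁₂.E U₃.E := by
  rw [S₁₂_E, U₃_E, ← Finset.coe_union, Finset.disjoint_coe]; decide

/-- `(U₁ ⊕ U₂) ⊕ U₃`. -/
noncomputable def S₁₂₃ : Matroid ℕ := S₁₂.disjointSum U₃ h₁₂₃

/-- The ground set of `S₁₂₃`. -/
lemma S₁₂₃_E : S₁₂₃.E = ((E₁ : Set ℕ) ∪ (E₂ : Set ℕ)) ∪ (E₃ : Set ℕ) := by
  rw [S₁₂₃, Matroid.disjointSum_ground_eq, S₁₂_E, U₃_E]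

/-- `S₁₂₃` and `U₄` have disjoint ground sets. -/
lemma h₁₂₃₄ : Disjoint S₁₂₃.E U₄.E := by
  rw [S₁₂₃_E, U₄_E, ← Finset.coe_union, ← Finset.coe_union, Finset.disjoint_coe]; decide

/-- **The witness** `W = ((U₁ ⊕ U₂) ⊕ U₃) ⊕ U₄`, a 12-element direct sum of four uniform matroids. -/
noncomputable def W : Matroid ℕ := S₁₂₃.disjointSum U₄ h₁₂₃₄

/-- The ground set of the witness. -/
lemma W_E : W.E = (((E₁ : Set ℕ) ∪ (E₂ : Set ℕ)) ∪ (E₃ : Set ℕ)) ∪ (E₄ : Set ℕ) := by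
  rw [W, Matroid.disjointSum_ground_eq, S₁₂₃_E, U₄_E]

/-- `U₁` is finite. -/
lemma U₁_finite : U₁.Finite := modelMatroid_finite _ ∅ 2 2
/-- `U₂` is finite. -/
lemma U₂_finite : U₂.Finite := modelMatroid_finite _ ∅ 2 2
/-- `U₃` is finite. -/
lemma U₃_finite : U₃.Finite := modelMatroid_finite _ ∅ 3 3
/-- `U₄` is finite. -/
lemma U₄_finite : U₄.Finite := modelMatroid_finite _ ∅ 1 1
/-- `S₁₂` is finite. -/
lemma S₁₂_finite : S₁₂.Finite := ⟨by rw [S₁₂_E, ← Finset.coe_union]; exact Finset.finite_toSet _⟩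
/-- `S₁₂₃` is finite. -/
lemma S₁₂₃_finite : S₁₂₃.Finite := ⟨by rw [S₁₂₃_E, ← Finset.coe_union, ← Finset.coe_union]; exact Finset.finite_toSet _⟩
/-- The witness is finite. -/
lemma W_finite : W.Finite :=
  ⟨by rw [W_E, ← Finset.coe_union, ← Finset.coe_union, ← Finset.coe_union]; exact Finset.finite_toSet _⟩

/-- The signature: `Y₁ = {0, 1, 10}`. -/
def Y₁ : Finset ℕ := {0, 1, 10}
/-- The signature: `Y₂ = {3, 6}`. -/
def Y₂ : Finset ℕ := {3, 6}

/-! ## The four uniform profiles -/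

/-- `U₁ = U_{2,3}` with `({0,1}, ∅)`: the profile is `(1, 0, 0, …)`. -/
lemma prof₁ (i : ℕ) : minorPairCount U₁ (({0, 1} : Finset ℕ) : Set ℕ) (∅ : Set ℕ) i = if i = 0 then 1 else 0 := by
  rw [U₁, minorPairCount_uniform _ 2 2 (by rw [Finset.coe_subset]; decide) (Set.empty_subset _)]
  have hm : ((E₁ : Set ℕ) \ (↑({0, 1} : Finset ℕ) ∪ (∅ : Set ℕ))).ncard = 1 := by
    rw [Set.union_empty, ← Finset.coe_sdiff, Set.ncard_coe_finset]; decide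
  have hc : ({0, 1} : Finset ℕ).card = 2 := by decide
  rw [hm, Set.ncard_coe_finset, Set.ncard_empty, hc]
  rcases i with _ | i
  · simp
  · rw [if_neg (by omega), if_neg (by omega)]

/-- `U₂ = U_{2,3}` with `(∅, {3})`: the profile is `(0, 2, 1, 0, …)`. -/
lemma prof₂ (i : ℕ) : minorPairCount U₂ (∅ : Set ℕ) (({3} : Finset ℕ) : Set ℕ) i =
    if 1 ≤ i ∧ i ≤ 2 then Nat.choose 2 i else 0 := by
  rw [U₂, minorPairCount_uniform _ 2 2 (Set.empty_subset _) (by rw [Finset.coe_subset]; decide)]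
  have hm : ((E₂ : Set ℕ) \ ((∅ : Set ℕ) ∪ ↑({3} : Finset ℕ))).ncard = 2 := by
    rw [Set.empty_union, ← Finset.coe_sdiff, Set.ncard_coe_finset]; decide
  rw [hm, Set.ncard_coe_finset, Set.ncard_empty]
  by_cases h : 1 ≤ i ∧ i ≤ 2
  · rw [if_pos h, if_pos (by simp only [Finset.card_singleton]; omega)]
  · rw [if_neg h, if_neg (by simp only [Finset.card_singleton]; omega)]

/-- `U₃ = U_{3,4}` with `(∅, {6})`: the profile is `(0, 3, 3, 1, 0, …)`. -/
lemma prof₃ (i : ℕ) : minorPairCount U₃ (∅ : Set ℕ) (({6} : Finset ℕ) : Set ℕ) i =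
    if 1 ≤ i ∧ i ≤ 3 then Nat.choose 3 i else 0 := by
  rw [U₃, minorPairCount_uniform _ 3 3 (Set.empty_subset _) (by rw [Finset.coe_subset]; decide)]
  have hm : ((E₃ : Set ℕ) \ ((∅ : Set ℕ) ∪ ↑({6} : Finset ℕ))).ncard = 3 := by
    rw [Set.empty_union, ← Finset.coe_sdiff, Set.ncard_coe_finset]; decide
  rw [hm, Set.ncard_coe_finset, Set.ncard_empty]
  by_cases h : 1 ≤ i ∧ i ≤ 3
  · rw [if_pos h, if_pos (by simp only [Finset.card_singleton]; omega)]
  · rw [if_neg h, if_neg (by simp only [Finset.card_singleton]; omega)]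

/-- `U₄ = U_{1,2}` with `({10}, ∅)`: the profile is `(1, 0, …)`. -/
lemma prof₄ (i : ℕ) : minorPairCount U₄ (({10} : Finset ℕ) : Set ℕ) (∅ : Set ℕ) i = if i = 0 then 1 else 0 := by
  rw [U₄, minorPairCount_uniform _ 1 1 (by rw [Finset.coe_subset]; decide) (Set.empty_subset _)]
  have hm : ((E₄ : Set ℕ) \ (↑({10} : Finset ℕ) ∪ (∅ : Set ℕ))).ncard = 1 := by
    rw [Set.union_empty, ← Finset.coe_sdiff, Set.ncard_coe_finset]; decide
  have hc : ({10} : Finset ℕ).card = 1 := by decide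
  rw [hm, Set.ncard_coe_finset, Set.ncard_empty, hc]
  rcases i with _ | i
  · simp
  · rw [if_neg (by omega), if_neg (by omega)]

/-! ## The convolutions -/

/-- A convolution with the delta at `0` on the left. -/
lemma delta_conv (g : ℕ → ℕ) (i : ℕ) :
    ∑ a ∈ Finset.range (i + 1), (if a = 0 then 1 else 0) * g a = g 0 := by
  rw [Finset.sum_range_succ']
  simp only [Nat.add_eq_zero_iff, one_ne_zero, and_false, if_false, zero_mul, Finset.sum_const_zero,
    if_true, one_mul, zero_add]

/-- A convolution with the delta at `0` on the right. -/
lemma conv_delta (f : ℕ → ℕ) (i : ℕ) :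
    ∑ a ∈ Finset.range (i + 1), f a * (if i - a = 0 then 1 else 0) = f i := by
  rw [Finset.sum_range_succ, Nat.sub_self, if_pos rfl, mul_one]
  rw [Finset.sum_eq_zero (fun a ha => ?_), zero_add]
  rw [Finset.mem_range] at ha
  rw [if_neg (by omega), mul_zero]

/-- `S₁₂ = U₁ ⊕ U₂` with `({0,1}, {3})`: the profile is `(0, 2, 1, 0, …)` (the `U₁`-factor is a delta). -/
lemma prof₁₂ (i : ℕ) : minorPairCount S₁₂ (({0, 1} : Finset ℕ) : Set ℕ) (({3} : Finset ℕ) : Set ℕ) i =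
    if 1 ≤ i ∧ i ≤ 2 then Nat.choose 2 i else 0 := by
  haveI := U₁_finite; haveI := U₂_finite
  have e1 : (({0, 1} : Finset ℕ) : Set ℕ) = (({0, 1} : Finset ℕ) : Set ℕ) ∪ (∅ : Set ℕ) := by simp
  have e2 : (({3} : Finset ℕ) : Set ℕ) = (∅ : Set ℕ) ∪ (({3} : Finset ℕ) : Set ℕ) := by simp
  rw [S₁₂, e1, e2, minorPairCount_disjointSum (h := h₁₂) (by rw [U₁_E, Finset.coe_subset]; decide)
    (Set.empty_subset _) (Set.empty_subset _) (by rw [U₂_E, Finset.coe_subset]; decide)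
    (Set.disjoint_empty _) (Set.empty_disjoint _)]
  simp only [prof₁, prof₂]
  rw [delta_conv (fun a => if 1 ≤ i - a ∧ i - a ≤ 2 then Nat.choose 2 (i - a) else 0), Nat.sub_zero]

/-- `S₁₂₃ = S₁₂ ⊕ U₃` with `({0,1}, {3,6})`: the convolution `(0,2,1) ⋆ (0,3,3,1)`. -/
lemma prof₁₂₃ (i : ℕ) :
    minorPairCount S₁₂₃ (({0, 1} : Finset ℕ) : Set ℕ) (({3, 6} : Finset ℕ) : Set ℕ) i =
      ∑ a ∈ Finset.range (i + 1), (if 1 ≤ a ∧ a ≤ 2 then Nat.choose 2 a else 0) *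
        (if 1 ≤ i - a ∧ i - a ≤ 3 then Nat.choose 3 (i - a) else 0) := by
  haveI := S₁₂_finite; haveI := U₃_finite
  have e1 : (({0, 1} : Finset ℕ) : Set ℕ) = (({0, 1} : Finset ℕ) : Set ℕ) ∪ (∅ : Set ℕ) := by simp
  have e2 : (({3, 6} : Finset ℕ) : Set ℕ) = (({3} : Finset ℕ) : Set ℕ) ∪ (({6} : Finset ℕ) : Set ℕ) := by
    rw [← Finset.coe_union]; congr 1
  rw [S₁₂₃, e1, e2, minorPairCount_disjointSum (h := h₁₂₃)
    (by rw [S₁₂_E, ← Finset.coe_union, Finset.coe_subset]; decide)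
    (by rw [S₁₂_E, ← Finset.coe_union, Finset.coe_subset]; decide)
    (Set.empty_subset _) (by rw [U₃_E, Finset.coe_subset]; decide)
    (by rw [Finset.disjoint_coe]; decide) (Set.empty_disjoint _)]
  simp only [prof₁₂, prof₃]

/-- `p₂ = 6` for `S₁₂₃`. -/
lemma prof₁₂₃_two : minorPairCount S₁₂₃ (({0, 1} : Finset ℕ) : Set ℕ) (({3, 6} : Finset ℕ) : Set ℕ) 2 = 6 := by
  rw [prof₁₂₃]; decide

/-- `p₄ = 5` for `S₁₂₃`. -/
lemma prof₁₂₃_four : minorPairCount S₁₂₃ (({0, 1} : Finset ℕ) : Set ℕ) (({3, 6} : Finset ℕ) : Set ℕ) 4 = 5 := by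
  rw [prof₁₂₃]; decide

/-- The witness `W = S₁₂₃ ⊕ U₄` with `(Y₁, Y₂) = ({0,1,10}, {3,6})`: the `U₄`-factor is a delta, so the profile
is that of `S₁₂₃`. -/
lemma profW (i : ℕ) : minorPairCount W (Y₁ : Set ℕ) (Y₂ : Set ℕ) i =
    minorPairCount S₁₂₃ (({0, 1} : Finset ℕ) : Set ℕ) (({3, 6} : Finset ℕ) : Set ℕ) i := by
  haveI := S₁₂₃_finite; haveI := U₄_finite
  have e1 : (Y₁ : Set ℕ) = (({0, 1} : Finset ℕ) : Set ℕ) ∪ (({10} : Finset ℕ) : Set ℕ) := by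
    rw [← Finset.coe_union]; congr 1
  have e2 : (Y₂ : Set ℕ) = (({3, 6} : Finset ℕ) : Set ℕ) ∪ (∅ : Set ℕ) := by simp [Y₂]
  rw [W, e1, e2, minorPairCount_disjointSum (h := h₁₂₃₄)
    (by rw [S₁₂₃_E, ← Finset.coe_union, ← Finset.coe_union, Finset.coe_subset]; decide)
    (by rw [S₁₂₃_E, ← Finset.coe_union, ← Finset.coe_union, Finset.coe_subset]; decide)
    (by rw [U₄_E, Finset.coe_subset]; decide) (Set.empty_subset _)
    (by rw [Finset.disjoint_coe]; decide) (Set.disjoint_empty _)]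
  simp only [prof₄]
  exact conv_delta _ i

/-! ## Ranks and independence in the witness -/

/-- The ground set of the witness as a finset. -/
def Eall : Finset ℕ := E₁ ∪ E₂ ∪ E₃ ∪ E₄

/-- The ground set of the witness as a coerced finset. -/
lemma W_E' : W.E = (Eall : Set ℕ) := by
  rw [W_E, Eall, Finset.coe_union, Finset.coe_union, Finset.coe_union]

/-- **The rank of a subset of the witness** is the sum of the truncated trace sizes. -/
lemma rk_W (F : Finset ℕ) (hF : (F : Set ℕ) ⊆ W.E) :
    mpRk W (F : Set ℕ) =
      min (F ∩ E₁).card 2 + min (F ∩ E₂).card 2 + min (F ∩ E₃).card 3 + min (F ∩ E₄).card 1 := by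
  haveI := S₁₂₃_finite; haveI := U₄_finite; haveI := S₁₂_finite; haveI := U₃_finite
  haveI := U₁_finite; haveI := U₂_finite
  have hF1 : (F : Set ℕ) ⊆ S₁₂₃.E ∪ U₄.E := by rw [← Matroid.disjointSum_ground_eq]; exact hF
  rw [W, mpRk_disjointSum (h := h₁₂₃₄) hF1, S₁₂₃_E, U₄_E, ← Finset.coe_union, ← Finset.coe_union,
    ← Finset.coe_inter, ← Finset.coe_inter]
  have hF2 : ((F ∩ (E₁ ∪ E₂ ∪ E₃) : Finset ℕ) : Set ℕ) ⊆ S₁₂.E ∪ U₃.E := by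
    rw [S₁₂_E, U₃_E, ← Finset.coe_union, ← Finset.coe_union, Finset.coe_subset]
    exact Finset.inter_subset_right
  rw [S₁₂₃, mpRk_disjointSum (h := h₁₂₃) hF2, S₁₂_E, U₃_E, ← Finset.coe_union, ← Finset.coe_inter,
    ← Finset.coe_inter]
  have hF3 : ((F ∩ (E₁ ∪ E₂ ∪ E₃) ∩ (E₁ ∪ E₂) : Finset ℕ) : Set ℕ) ⊆ U₁.E ∪ U₂.E := by
    rw [U₁_E, U₂_E, ← Finset.coe_union, Finset.coe_subset]
    exact Finset.inter_subset_right
  rw [S₁₂, mpRk_disjointSum (h := h₁₂) hF3, U₁_E, U₂_E, ← Finset.coe_inter, ← Finset.coe_inter]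
  rw [U₁, U₂, U₃, U₄,
    mpRk_uniform _ 2 (by rw [Finset.coe_subset]; exact Finset.inter_subset_right),
    mpRk_uniform _ 2 (by rw [Finset.coe_subset]; exact Finset.inter_subset_right),
    mpRk_uniform _ 3 (by rw [Finset.coe_subset]; exact Finset.inter_subset_right),
    mpRk_uniform _ 1 (by rw [Finset.coe_subset]; exact Finset.inter_subset_right),
    Set.ncard_coe_finset, Set.ncard_coe_finset, Set.ncard_coe_finset, Set.ncard_coe_finset]
  have t1 : F ∩ (E₁ ∪ E₂ ∪ E₃) ∩ (E₁ ∪ E₂) ∩ E₁ = F ∩ E₁ := by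
    ext x; simp only [Finset.mem_inter, Finset.mem_union]; tauto
  have t2 : F ∩ (E₁ ∪ E₂ ∪ E₃) ∩ (E₁ ∪ E₂) ∩ E₂ = F ∩ E₂ := by
    ext x; simp only [Finset.mem_inter, Finset.mem_union]; tauto
  have t3 : F ∩ (E₁ ∪ E₂ ∪ E₃) ∩ E₃ = F ∩ E₃ := by
    ext x; simp only [Finset.mem_inter, Finset.mem_union]; tauto
  rw [t1, t2, t3]

/-- **Independence in the witness**: the traces on the four summands are small. -/
lemma indep_W (F : Finset ℕ) :
    W.Indep (F : Set ℕ) ↔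
      F ⊆ Eall ∧ (F ∩ E₁).card ≤ 2 ∧ (F ∩ E₂).card ≤ 2 ∧ (F ∩ E₃).card ≤ 3 ∧ (F ∩ E₄).card ≤ 1 := by
  rw [W, Matroid.disjointSum_indep_iff, S₁₂₃_E, U₄_E]
  rw [S₁₂₃, Matroid.disjointSum_indep_iff, S₁₂_E, U₃_E]
  rw [S₁₂, Matroid.disjointSum_indep_iff, U₁_E, U₂_E]
  rw [U₁, U₂, U₃, U₄]
  simp only [uniform_indep_iff, ← Finset.coe_union, ← Finset.coe_inter, Set.ncard_coe_finset, Finset.coe_subset]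
  have t1 : F ∩ (E₁ ∪ E₂ ∪ E₃) ∩ (E₁ ∪ E₂) ∩ E₁ = F ∩ E₁ := by
    ext x; simp only [Finset.mem_inter, Finset.mem_union]; tauto
  have t2 : F ∩ (E₁ ∪ E₂ ∪ E₃) ∩ (E₁ ∪ E₂) ∩ E₂ = F ∩ E₂ := by
    ext x; simp only [Finset.mem_inter, Finset.mem_union]; tauto
  have t3 : F ∩ (E₁ ∪ E₂ ∪ E₃) ∩ E₃ = F ∩ E₃ := by
    ext x; simp only [Finset.mem_inter, Finset.mem_union]; tauto
  rw [t1, t2, t3, Eall]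
  constructor
  · rintro ⟨⟨⟨⟨-, h1⟩, ⟨-, h2⟩, -⟩, ⟨-, h3⟩, -⟩, ⟨-, h4⟩, hsub⟩
    exact ⟨hsub, h1, h2, h3, h4⟩
  · rintro ⟨hsub, h1, h2, h3, h4⟩
    exact ⟨⟨⟨⟨Finset.inter_subset_right, h1⟩, ⟨Finset.inter_subset_right, h2⟩, Finset.inter_subset_right⟩,
      ⟨Finset.inter_subset_right, h3⟩, Finset.inter_subset_right⟩, ⟨Finset.inter_subset_right, h4⟩, hsub⟩

/-! ## The refutation -/

/-- **(M₀) IS FALSE**: the witness `W` with the signature `({0,1,10}, {3,6})` has equal-rank complementary minors and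
`p₂ = 6 > p₄ = 5` with `2 + 4 = m − 1 = 6`. -/
theorem not_minorPairEqualRankSkew_witness : ¬ MinorPairEqualRankSkew W := by
  intro hM
  haveI := W_finite
  have hY₁ : (Y₁ : Set ℕ) ⊆ W.E := by rw [W_E', Finset.coe_subset]; decide
  have hY₂ : (Y₂ : Set ℕ) ⊆ W.E := by rw [W_E', Finset.coe_subset]; decide
  have hdisj : Disjoint (Y₁ : Set ℕ) (Y₂ : Set ℕ) := by rw [Finset.disjoint_coe]; decide
  have hI₁ : W.Indep (Y₁ : Set ℕ) := (indep_W Y₁).mpr (by decide)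
  have hI₂ : W.Indep (Y₂ : Set ℕ) := (indep_W Y₂).mpr (by decide)
  have hrk : mpRk W (W.E \ (Y₂ : Set ℕ)) + (Y₂ : Set ℕ).ncard =
      mpRk W (W.E \ (Y₁ : Set ℕ)) + (Y₁ : Set ℕ).ncard := by
    rw [W_E', ← Finset.coe_sdiff, ← Finset.coe_sdiff,
      rk_W _ (by rw [W_E', Finset.coe_subset]; exact Finset.sdiff_subset),
      rk_W _ (by rw [W_E', Finset.coe_subset]; exact Finset.sdiff_subset), Set.ncard_coe_finset,
      Set.ncard_coe_finset]
    decide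
  have hm : (W.E \ ((Y₁ : Set ℕ) ∪ (Y₂ : Set ℕ))).ncard = 7 := by
    rw [W_E', ← Finset.coe_union, ← Finset.coe_sdiff, Set.ncard_coe_finset]; decide
  have h24 := hM (Y₁ : Set ℕ) (Y₂ : Set ℕ) hY₁ hY₂ hdisj hI₁ hI₂ hrk 2 4 (by norm_num) (by rw [hm])
  rw [profW, profW, prof₁₂₃_two, prof₁₂₃_four] at h24
  omega

/-- **(Diag) IS FALSE**: through `minorPairEqualRankSkew_of_diagSkew`. -/
theorem not_minorPairDiagSkew_witness : ¬ MinorPairDiagSkew W := by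
  intro h
  haveI := W_finite
  exact not_minorPairEqualRankSkew_witness (minorPairEqualRankSkew_of_diagSkew W h)

end MinorPairWitness

end PercRepro
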